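import Summits.QuantumAdvantage.QuantumAdvantage.Theorems.StabilizerDialGauge
import Summits.QuantumAdvantage.AdviceFreeQNC0.WalkTubeRank
import HarnessLib

/-!
# StabilizerDialAntipodal — the antipodal pointer family is generic at every window / gauge parameter
(cell decomp-qadv, seat lens-2 g17, node «StabilizerDial»; supports item 26531 `ExactnessDial.PolyLossOddU3`)

`AntipodalGenericPos3`: for the ANTIPODAL POINTER family `apStrat j := t_j ⊕ [x_{j+⌊n/2⌋}]` (degree `3`) and every `(m, r, e)` there is
`n₀` with `¬ StabFew m r e apStrat` for all `n ≥ n₀` — no gauge `s` of degree `≤ (log₂ n)^e` makes the padded strategy `(m, r)`-few-locus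
(`StabFew`, `pad`, `rowMask` from `StabilizerDialGauge(A)`; `FewLocus`, `Coverable` from `LocusDialPieces`).  Consequently the hypothesis
class of the node's residual piece `StabGenericLossPos3` («every degree-`(log₂ n)^c` strategy that no degree-`(log₂ n)^{c+1}` gauge makes
`(m+1, r)`-few-locus loses a polynomial fraction of the odd class») is NON-EMPTY at every `(m, r, c)` with `c ≥ 1`
(`antipodal_class_nonempty`; at `c = 0` the class consists of degree-`≤ 1` strategies and this degree-3 family says nothing).

Proof.  §A the family and its deviation set (`mem_dev_pad_apStrat_iff`: position `j` of the pad deviates iff the gauge row bit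
`rowMask s x j` differs from the antipodal bit `x_{j+h}`, `h = ⌊N/2⌋`).  §B four lemmas:
* S1 `fibreIdentityAt_of_block` — on a block `B = [a, a+k)` on which the recurrence `rowMask s x j = x_{j+h}` holds, multiplying the block
  equations `β_{j+1} ⊕ β_{j-1} ⊕ x_j β_j = x_{j+h}` by an ADJOINT sequence `λ` solving the same homogeneous recurrence telescopes the interior
  gauge bits away: an 𝔽₂-functional `c` of the four boundary gauge bits equals `⊕_{i ∈ T} x_i` for a set `T ⊆ B + h` with
  `k/3 ≤ |T| ≤ 2k/3`, where `c, T` depend on the block's linear bits only (of the three non-zero seeds exactly two are `1` at each step);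
* S2 `oddSliceBound_holds` — ODD-SLICE SMOLENSKY: inside a parity slice `par_{T ∪ T'} = c` of a sub-cube, a degree-`D` polynomial over `𝔽₃`
  agrees with `ι(par_T)` on at most `2^{|T|+|T'|-2} + D·C(|T|,|T|/2)·2^{|T'|} + 2D·C(|T'|,|T'|/2)·2^{|T|}` points (the tree's
  `paritySubset_agreement_le` transported to sub-cubes by `comp_subst_mem_lowDeg` + sub-cube homogeneity, used once in the
  `T`-coordinates and once per `T`-pattern for the degree-`2D` indicator `indP` in the `T'`-coordinates);
* S12 `goodBound_of_blockRec` — fibre over the coordinates outside `F = B + h`: `OddZeros` is a parity slice of the `k` free bits and the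
  block recurrence makes the gated boundary polynomial (degree `≤ 8(log₂N)^e + 1`) agree with `ι(par_T)`; with `(m-1)·C(m,⌊m/2⌋)² ≤ 4^m`
  and `k ≥ 3456·(8(log₂N)^e+1)²` the good set has density `≤ 3/8`;
* S3 `blockSelect_of_fewLocus` — averaging the block position `a ∈ [1, N/2-k-1]` against the `m` windows of a few-locus input (each window
  meets `≤ k + r` blocks) and the `≤ 2^{N-1}/log₂N` non-coverable odd inputs.
§C growth bookkeeping (`TubePlanProof.logPow_le_natSqrt`); §D `antipodalGenericPos3_of` composes S1, S2, S12, S3 (`k := 3456·(8L^e+1)²`)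
and `antipodalGenericPos3` is the theorem.  No `sorry`; standard axioms; no instances, no notation.
-/

set_option linter.dupNamespace false
noncomputable section
open scoped Classical

namespace Summit.QuantumAdvantage.QuantumAdvantage.Theorems.StabilizerDial
open Finset
open Literature.Computability.QuantumComplexity Literature.Computability.QuantumComplexity.RingHLF
open Literature.Computability.MetaComplexity Literature.Computability.MetaComplexity.Smolensky
open Summit.QuantumAdvantage.AdviceFreeQNC0
open Summit.QuantumAdvantage.QuantumAdvantage.Theorems.HolonomyDial (selP selP_mem selP_apply xorP xorP_mem
  xorP_apply_bool tPoly tPoly_mem tPoly_apply mono_singleton_apply card_odd_le)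
open Summit.QuantumAdvantage.QuantumAdvantage.Theorems.AnchorDial (outB dev card_odd_ge)
open Summit.QuantumAdvantage.QuantumAdvantage.Theorems.LocusDial (Coverable FewLocus)
variable {N : ℕ}

/-! ## §A  The antipodal pointer family -/

/-- the antipodal index `j ↦ j + ⌊N/2⌋ (mod N)`. -/
def apIdx (j : Fin N) : Fin N := ⟨(j.val + N / 2) % N, Nat.mod_lt _ j.pos⟩

/-- **THE ANTIPODAL POINTER STRATEGY** `Pᵃ_j := t_j ⊕ [x_{j+⌊N/2⌋}]` (constant `𝔽₃`-degree `3`). -/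
def apStrat (j : Fin N) : CubeFn (ZMod 3) N := xorP (tPoly j) (mono (ZMod 3) {apIdx j})

/-- StabilizerDialAntipodal helper `apStrat_mem` (antipodal certificate; see the module docstring). -/
theorem apStrat_mem (j : Fin N) : apStrat j ∈ lowDeg (ZMod 3) N 3 := by
  have h : apStrat j ∈ lowDeg (ZMod 3) N (2 + 1) :=
    xorP_mem (tPoly_mem j) (mono_mem_lowDeg (Finset.card_singleton _).le)
  exact lowDeg_mono (by norm_num) h

/-- StabilizerDialAntipodal helper `apStrat_apply` (antipodal certificate; see the module docstring). -/
theorem apStrat_apply (j : Fin N) (x : Fin N → Bool) :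
    apStrat j x = if xor (tGuess x j) (x (apIdx j)) then 1 else 0 :=
  xorP_apply_bool _ _ x _ _ (tPoly_apply j x) (mono_singleton_apply _ x)

/-- StabilizerDialAntipodal helper `bitP_apStrat` (antipodal certificate; see the module docstring). -/
theorem bitP_apStrat (j : Fin N) (x : Fin N → Bool) : bitP (apStrat j) x = xor (tGuess x j) (x (apIdx j)) := by
  show decide (apStrat j x = 1) = _
  rw [apStrat_apply]
  generalize xor (tGuess x j) (x (apIdx j)) = q
  cases q <;> decide

/-- position `j` is a deviation of the padded antipodal strategy iff the RECURRENCE `(M(x)β(x))_j = x_{j+h}` FAILS at `j`. -/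
theorem mem_dev_pad_apStrat_iff (s : Fin N → CubeFn (ZMod 3) N) (x : Fin N → Bool) (j : Fin N) :
    j ∈ dev (pad (fun i => apStrat i) s) x ↔ rowMask s x j ≠ x (apIdx j) := by
  unfold AnchorDial.dev
  rw [mem_filter, show decide (pad (fun i => apStrat i) s j x = 1) = xor (bitP (apStrat j) x) (rowMask s x j) from
    bitP_pad _ s j x, bitP_apStrat]
  simp only [mem_univ, true_and]
  generalize tGuess x j = t; generalize x (apIdx j) = y; generalize rowMask s x j = w
  cases t <;> cases y <;> cases w <;> decide

/-- **THE GATING STATEMENT**: the antipodal family is generic at every `(m, r)` and every gauge level `e`. -/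
def AntipodalGenericPos3 : Prop := ∀ m r e : ℕ, ∃ n₀ : ℕ, ∀ n ≥ n₀, ¬ StabFew m r e (fun i : Fin n => apStrat i)

/-- the block recurrence holds on `[a, a+k)`: no deviation of the padded strategy there. -/
def BlockRec (s : Fin N → CubeFn (ZMod 3) N) (a k : ℕ) (x : Fin N → Bool) : Prop :=
  ∀ j : Fin N, a ≤ j.val → j.val < a + k → rowMask s x j = x (apIdx j)

/-- parity bit of `x` over a set of coordinates. -/
def parB (T : Finset (Fin N)) (x : Fin N → Bool) : Bool := decide ((T.filter fun i => x i = true).card % 2 = 1)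

/-! ## §B  The four lemmas S1, S2, S12, S3 -/

/-- **FIBRE IDENTITY at `(N, a, k)`**: some 𝔽₂-functional `c(x_B)` of the four boundary gauge bits `β_{a-1}, β_a, β_{a+k-1}, β_{a+k}`
and some set `T(x_B) ⊆ B + h` with `k/3 ≤ |T| ≤ 2k/3`, both depending on the LINEAR bits of the block only, such that the block
recurrence forces `c · β∂ = ⊕_{i ∈ T} x_i`. -/
def FibreIdentityAt (N a k : ℕ) : Prop :=
  ∃ (c : (Fin N → Bool) → Fin 4 → Bool) (T : (Fin N → Bool) → Finset (Fin N)),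
    (∀ x x' : Fin N → Bool, (∀ j : Fin N, a ≤ j.val → j.val < a + k → x j = x' j) → c x = c x' ∧ T x = T x') ∧
    (∀ x : Fin N → Bool, (∀ i ∈ T x, a + N / 2 ≤ i.val ∧ i.val < a + k + N / 2) ∧
      k ≤ 3 * (T x).card ∧ 3 * (T x).card ≤ 2 * k) ∧
    ∀ (x β : Fin N → Bool) (h0 : a - 1 < N) (h1 : a < N) (h2 : a + k - 1 < N) (h3 : a + k < N),
      (∀ j : Fin N, a ≤ j.val → j.val < a + k → rowVec x β j = x (apIdx j)) →
        xor (xor (c x 0 && β ⟨a - 1, h0⟩) (c x 1 && β ⟨a, h1⟩))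
            (xor (c x 2 && β ⟨a + k - 1, h2⟩) (c x 3 && β ⟨a + k, h3⟩)) = parB (T x) x

/-! ### S1 — the fibre identity, in SCALAR ADJOINT FORM (proved).
Multiply the block equations `E_j : β_{j+1} ⊕ β_{j-1} ⊕ x_j β_j = y_j` by an ADJOINT sequence `λ` solving the same homogeneous
recurrence `λ_{i+1} = λ_{i-1} ⊕ x_i λ_i`; the interior `β`'s telescope away, leaving four boundary gauge bits `= ⊕_{λ_j = 1} y_j`.
Of the three non-zero seeds exactly two have `λ_j = 1` at each `j` and none has two consecutive zeros, whence `k/3 ≤ |T| ≤ 2k/3`. -/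

/-- Boolean prefix XOR-sum `g 0 ⊕ ⋯ ⊕ g (t-1)`. -/
def xsum (g : ℕ → Bool) : ℕ → Bool
  | 0 => false
  | t + 1 => xor (xsum g t) (g t)

/-- StabilizerDialAntipodal helper `xsum_succ` (antipodal certificate; see the module docstring). -/
theorem xsum_succ (g : ℕ → Bool) (t : ℕ) : xsum g (t + 1) = xor (xsum g t) (g t) := rfl

/-- StabilizerDialAntipodal helper `xsum_congr` (antipodal certificate; see the module docstring). -/
theorem xsum_congr {g g' : ℕ → Bool} : ∀ {t : ℕ}, (∀ i < t, g i = g' i) → xsum g t = xsum g' t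
  | 0, _ => rfl
  | t + 1, h => by
    rw [xsum_succ, xsum_succ, xsum_congr (t := t) (fun i hi => h i (by omega)), h t (by omega)]

/-- StabilizerDialAntipodal helper `xsum_eq_parity` (antipodal certificate; see the module docstring). -/
theorem xsum_eq_parity (g : ℕ → Bool) : ∀ t : ℕ,
    xsum g t = decide (((Finset.range t).filter fun i => g i = true).card % 2 = 1)
  | 0 => by simp [xsum]
  | t + 1 => by
    rw [xsum_succ, xsum_eq_parity g t, Finset.range_add_one, Finset.filter_insert]
    cases hg : g t
    · simp
    · rw [if_pos rfl, Finset.card_insert_of_notMem (by simp)]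
      generalize ((Finset.range t).filter fun i => g i = true).card = c
      have : (c + 1) % 2 = (c % 2 + 1) % 2 := by omega
      rcases Nat.mod_two_eq_zero_or_one c with h | h <;> simp [this, h]

/-- the ADJOINT SEQUENCE of a block word `w` with seed `(u, v)`: `λ₀ = u`, `λ₁ = v`, `λ_{i+2} = λ_i ⊕ w_{i+1} λ_{i+1}`. -/
def lam (w : ℕ → Bool) (u v : Bool) : ℕ → Bool
  | 0 => u
  | 1 => v
  | i + 2 => xor (lam w u v i) (w (i + 1) && lam w u v (i + 1))

/-- StabilizerDialAntipodal helper `lam_rec` (antipodal certificate; see the module docstring). -/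
theorem lam_rec (w : ℕ → Bool) (u v : Bool) (i : ℕ) :
    lam w u v (i + 2) = xor (lam w u v i) (w (i + 1) && lam w u v (i + 1)) := rfl

/-- TELESCOPING: `⊕_{i<d+2} λ_i E_i` has only boundary terms. -/
theorem lam_telescope (w Bs : ℕ → Bool) (u v : Bool) (d : ℕ) :
    xsum (fun i => lam w u v i && xor (xor (Bs i) (Bs (i + 2))) (w i && Bs (i + 1))) (d + 2) =
      xor (xor (lam w u v 0 && Bs 0) (xor (lam w u v 1) (lam w u v 0 && w 0) && Bs 1))
          (xor (xor (lam w u v d) (lam w u v (d + 1) && w (d + 1)) && Bs (d + 2))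
            (lam w u v (d + 1) && Bs (d + 3))) := by
  induction d with
  | zero =>
    show xor (xor false (lam w u v 0 && xor (xor (Bs 0) (Bs 2)) (w 0 && Bs 1)))
        (lam w u v 1 && xor (xor (Bs 1) (Bs 3)) (w 1 && Bs 2)) = _
    generalize lam w u v 0 = l0; generalize lam w u v 1 = l1
    generalize w 0 = a0; generalize w 1 = a1
    generalize Bs 0 = b0; generalize Bs 1 = b1; generalize Bs 2 = b2; generalize Bs 3 = b3
    revert l0 l1 a0 a1 b0 b1 b2 b3; decide
  | succ d ih =>
    rw [show d + 1 + 2 = (d + 2) + 1 from rfl, xsum_succ, ih]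
    rw [show d + 2 + 2 = d + 4 from rfl, show d + 2 + 1 = d + 3 from rfl, show d + 1 + 1 = d + 2 from rfl,
      show d + 1 + 3 = d + 4 from rfl, lam_rec w u v d]
    generalize xor (lam w u v 0 && Bs 0) (xor (lam w u v 1) (lam w u v 0 && w 0) && Bs 1) = P
    generalize lam w u v d = ld; generalize lam w u v (d + 1) = le
    generalize w (d + 1) = w1; generalize w (d + 2) = w2
    generalize Bs (d + 2) = b2; generalize Bs (d + 3) = b3; generalize Bs (d + 4) = b4
    revert P ld le w1 w2 b2 b3 b4; decide

/-- a non-zero seed never produces two consecutive zeros. -/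
theorem lam_pair_ne (w : ℕ → Bool) {u v : Bool} (huv : ¬ (u = false ∧ v = false)) :
    ∀ i, ¬ (lam w u v i = false ∧ lam w u v (i + 1) = false) := by
  intro i
  induction i with
  | zero => exact huv
  | succ i ih =>
    rintro ⟨h1, h2⟩
    have hrec : lam w u v (i + 1 + 1) = xor (lam w u v i) (w (i + 1) && lam w u v (i + 1)) := rfl
    rw [h1, Bool.and_false, Bool.xor_false] at hrec
    exact ih ⟨hrec ▸ h2, h1⟩

/-- linearity in the seed. -/
theorem lam_xor (w : ℕ → Bool) (u u' v v' : Bool) (i : ℕ) :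
    lam w (xor u u') (xor v v') i = xor (lam w u v i) (lam w u' v' i) := by
  have key : ∀ i, lam w (xor u u') (xor v v') i = xor (lam w u v i) (lam w u' v' i) ∧
      lam w (xor u u') (xor v v') (i + 1) = xor (lam w u v (i + 1)) (lam w u' v' (i + 1)) := by
    intro i
    induction i with
    | zero => exact ⟨rfl, rfl⟩
    | succ i ih =>
      refine ⟨ih.2, ?_⟩
      rw [show i + 1 + 1 = i + 2 from rfl, lam_rec, lam_rec, lam_rec, ih.1, ih.2]
      generalize lam w u v i = p; generalize lam w u' v' i = q
      generalize lam w u v (i + 1) = p'; generalize lam w u' v' (i + 1) = q'; generalize w (i + 1) = c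
      revert p q p' q' c; decide
  exact (key i).1

/-- at every index exactly two of the three non-zero seeds give `λ_i = 1`. -/
theorem lam_two_of_three (w : ℕ → Bool) (i : ℕ) :
    (if lam w true false i = true then 1 else 0) + (if lam w false true i = true then 1 else 0) +
      (if lam w true true i = true then 1 else 0) = 2 := by
  have hx : lam w true true i = xor (lam w true false i) (lam w false true i) := lam_xor w true false false true i
  have hx1 : lam w true true (i + 1) = xor (lam w true false (i + 1)) (lam w false true (i + 1)) :=
    lam_xor w true false false true (i + 1)
  have h10 := lam_pair_ne w (u := true) (v := false) (by simp) i
  have h01 := lam_pair_ne w (u := false) (v := true) (by simp) i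
  have h11 := lam_pair_ne w (u := true) (v := true) (by simp) i
  rw [hx1, hx] at h11
  rw [hx]
  revert h10 h01 h11
  generalize lam w true false i = p; generalize lam w false true i = q
  generalize lam w true false (i + 1) = p'; generalize lam w false true (i + 1) = q'
  revert p q p' q'; decide

/-- no two consecutive zeros ⇒ at most `(k+1)/2` zeros among the first `k` indices. -/
theorem lam_false_card_le (w : ℕ → Bool) {u v : Bool} (huv : ¬ (u = false ∧ v = false)) (k : ℕ) :
    2 * ((Finset.range k).filter fun t => lam w u v t = false).card ≤ k + 1 := by
  have h2 : ∀ k, ((Finset.range (k + 2)).filter fun t => lam w u v t = false).card ≤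
      ((Finset.range k).filter fun t => lam w u v t = false).card + 1 := by
    intro k
    rw [Finset.range_add_one, Finset.filter_insert, Finset.range_add_one, Finset.filter_insert]
    have hne := lam_pair_ne w huv k
    by_cases h1 : lam w u v (k + 1) = false
    · have h0 : ¬ lam w u v k = false := fun h0 => hne ⟨h0, h1⟩
      rw [if_pos h1, if_neg h0]
      exact Finset.card_insert_le _ _
    · rw [if_neg h1]
      by_cases h0 : lam w u v k = false
      · rw [if_pos h0]; exact Finset.card_insert_le _ _
      · rw [if_neg h0]; omega
  have key : ∀ k, 2 * ((Finset.range k).filter fun t => lam w u v t = false).card ≤ k + 1 ∧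
      2 * ((Finset.range (k + 1)).filter fun t => lam w u v t = false).card ≤ k + 1 + 1 := by
    intro k
    induction k with
    | zero =>
      refine ⟨by simp, ?_⟩
      have : ((Finset.range (0 + 1)).filter fun t => lam w u v t = false).card ≤ 1 :=
        le_trans (Finset.card_filter_le _ _) (by simp)
      omega
    | succ k ih =>
      refine ⟨ih.2, ?_⟩
      have := h2 k
      rw [show k + 1 + 1 = k + 2 from rfl]
      omega
  exact (key k).1


end Summit.QuantumAdvantage.QuantumAdvantage.Theorems.StabilizerDial
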